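import Literature.Analysis.FluidPDE.CollisionCylinder
import Literature.Analysis.FluidPDE.HardSphereBilliard
import Literature.MathematicalPhysics.KineticTheory.Hilbert6Wave0
import HarnessLib

/-!
# The marked collision cylinder of finite length: Boltzmann's flux factor with the impact direction as a mark
(Cercignani–Illner–Pulvirenti 1994, App. 4.A p. 108, "the cylinder change of variables `x = ε n - τ v`,
`dx = ε^{d-1} |v · n| dσ(n) dτ`", and §2.3 / §4.4 p. 86: in a time window of length `Δ` a partner with relative
velocity `-u` collides with the tagged sphere iff it sits in the collision cylinder of length `Δ |u|`, and the
contacts it produces are distributed on the incoming hemisphere with the flux weight `(u · n)₊`; Gallagher–Saint-Raymond–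
Texier 2013, (4.3.6); trunk T-KINETIC, topic Analysis/FluidPDE (hard-sphere dynamics).)

This file complements `Literature.Analysis.FluidPDE.CollisionCylinder` (the cylinder of INFINITE length,
`lintegral_collisionCylinder`) with the version every short-time / Lanford-window argument consumes:

* `collisionCylDomUpTo u Δ`, `collisionCylRegionUpTo ε u Δ` — the direction–time parameters with flight time `≤ Δ` and
  the **collision cylinder of length `Δ`**, `{ε ν + τ u | ⟪u, ν⟫ > 0, 0 < τ ≤ Δ}`;
* kinematics ON the cylinder in the currency of `HardSphereBilliard` (`pairDisc`, `pairHitTime`, `hitPoint`,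
  `billiardGood`): the relative datum `(ε ν + τ u, -u)` is billiard-good, its first hitting time is `τ` and its hit point
  (separation vector at contact) is `ε ν` (`pairHitTime_cylPoint`, `hitPoint_cylPoint`, `cylPoint_mem_billiardGood`), and
  conversely **the cylinder of length `Δ` is exactly the set of relative positions `q` with `(q, -u) ∈ billiardGood ε` and
  `pairHitTime ε q (-u) ≤ Δ`** (`mem_collisionCylRegionUpTo_iff`) — the set that `HardSphereShortTime.hitPiece` is cut from;
* `lintegral_collisionCylinderUpTo` — the cylinder formula with `∫⁻ τ in Ioc 0 Δ`;
* `lintegral_collisionCylinderUpTo_of_mark`, `lintegral_collisionCylinderUpTo_hitPoint` — **the marked cylinder identity**: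
  for a test depending on `q` only through the impact direction `ε⁻¹ · hitPoint ε (q, -u)`,
  `∫⁻_{cyl_Δ} Ψ(ε⁻¹ hitPoint) dq = Δ · ∫_{S} ε^{d-1} (⟪u, ν⟫)₊ Ψ(ν) dσ(ν)`;
* `map_hitDir_restrict_collisionCylRegionUpTo` — the same as a push-forward identity of measures, whence the Bochner form
  `integral_collisionCylinderUpTo_hitPoint` for real tests;
* `lintegral_collisionCylinderUpTo_hardSphereKernel`, `integral_collisionCylinderUpTo_hardSphereKernel` — the identity
  in the currency of the kinetic-theory files (`hardSphereKernel (w, v) ω = (⟪w - v, ω⟫)₊`, `sphereMeasure = volume.toSphere`):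
  for two particles with velocities `v` (tagged) and `w` (partner), relative position `q = x_tagged - x_partner`,
  `∫_{cyl_Δ} Ψ(ε⁻¹ hitPoint ε (q, v - w)) dq = Δ ε^{d-1} ∫ Ψ(ω) hardSphereKernel (w, v) ω d sphereMeasure(ω)` — with
  `ω = ε⁻¹ (x_tagged - x_partner)` at contact, the convention of the empirical collision measures of the hydrodynamic-limit
  statements (`ε⁻¹ • sepVec x_i x_j`, pre-collisional marks, flux factor `((w - v) · ω)₊`).

## Mathlib / Literature reuse

`lintegral_image_eq_lintegral_abs_det_fderiv_mul` (change of variables), `lintegral_polar`, `det_collisionCylDeriv`,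
`injOn_collisionCylMap`, `collisionCylMap_smul_unit` (CollisionCylinder.lean); `pairHitTime_pos`, `norm_hitPoint`,
`inner_hitPoint_neg`, `PairHits.of_mem_billiardGood` (HardSphereBilliard.lean); `integral_map`,
`integral_withDensity_eq_integral_toReal_smul`. Nothing is redefined.

## References

* C. Cercignani, R. Illner, M. Pulvirenti, *The Mathematical Theory of Dilute Gases*, Springer (1994), §2.3, §4.4 p. 86,
  App. 4.A p. 108. [CIP1994]
* I. Gallagher, L. Saint-Raymond, B. Texier, *From Newton to Boltzmann*, EMS (2013), arXiv:1208.5753, (4.3.6). [GST2013]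
-/

open MeasureTheory MeasureTheory.Measure Metric Real Set Filter Function Module
open scoped ENNReal InnerProductSpace Topology

namespace Literature.Analysis.FluidPDE

noncomputable section

section Kinetic

variable {V : Type*} [NormedAddCommGroup V] [InnerProductSpace ℝ V]

/-! ## §1. Kinematics on the collision cylinder -/

/-- `‖ε ν + τ u‖² = ε² + 2 ε τ ⟪u, ν⟫ + τ² ‖u‖²` for a unit vector `ν`. [folklore] -/
theorem norm_cylPoint_sq (ε : ℝ) (u : V) {ν : V} (hν : ‖ν‖ = 1) (τ : ℝ) :
    ‖ε • ν + τ • u‖ ^ 2 = ε ^ 2 + 2 * ε * τ * ⟪u, ν⟫_ℝ + τ ^ 2 * ‖u‖ ^ 2 := by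
  rw [norm_add_sq_real, norm_smul, norm_smul, hν, mul_one, real_inner_smul_left, real_inner_smul_right,
    real_inner_comm u ν, Real.norm_eq_abs, Real.norm_eq_abs, sq_abs, mul_pow, sq_abs]
  ring

/-- `⟪ε ν + τ u, -u⟫ = -(ε ⟪u, ν⟫ + τ ‖u‖²)` for a unit vector `ν`. [folklore] -/
theorem inner_cylPoint_neg (ε : ℝ) (u : V) (ν : V) (τ : ℝ) :
    ⟪ε • ν + τ • u, -u⟫_ℝ = -(ε * ⟪u, ν⟫_ℝ + τ * ‖u‖ ^ 2) := by
  rw [inner_neg_right, inner_add_left, real_inner_smul_left, real_inner_smul_left, real_inner_self_eq_norm_sq,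
    real_inner_comm u ν]

/-- **The discriminant on the cylinder**: for the relative datum `(ε ν + τ u, -u)` (`ν` unit) the quarter-discriminant of
`HardSphereBilliard` is `(ε ⟪u, ν⟫)²`. [folklore] -/
theorem pairDisc_cylPoint (ε : ℝ) (u : V) {ν : V} (hν : ‖ν‖ = 1) (τ : ℝ) :
    pairDisc ε (ε • ν + τ • u) (-u) = (ε * ⟪u, ν⟫_ℝ) ^ 2 := by
  rw [pairDisc, inner_cylPoint_neg ε u ν τ, norm_neg, norm_cylPoint_sq ε u hν τ]
  ring

/-- **The hitting time on the cylinder**: the relative free motion started at `ε ν + τ u` with relative velocity `-u`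
(`ν` unit, `⟪u, ν⟫ ≥ 0`, `u ≠ 0`, `ε ≥ 0`) first reaches distance `ε` at time `τ` (CIP 1994 App. 4.A: `τ` IS the
flight-time coordinate). [cite: CIP1994, App. 4.A p. 108] -/
theorem pairHitTime_cylPoint {ε : ℝ} (hε : 0 ≤ ε) {u ν : V} (hν : ‖ν‖ = 1) (huν : 0 ≤ ⟪u, ν⟫_ℝ) (hu : u ≠ 0)
    (τ : ℝ) : pairHitTime ε (ε • ν + τ • u) (-u) = τ := by
  have hu2 : ‖u‖ ^ 2 ≠ 0 := pow_ne_zero 2 (norm_ne_zero_iff.2 hu)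
  rw [pairHitTime, pairDisc_cylPoint ε u hν τ, Real.sqrt_sq (mul_nonneg hε huν), inner_cylPoint_neg ε u ν τ,
    norm_neg, div_eq_iff hu2]
  ring

/-- **The hit point on the cylinder**: the separation vector at contact of the relative datum `(ε ν + τ u, -u)` is
`ε ν` — the impact direction `ν` is the mark read at the contact. [cite: CIP1994, App. 4.A p. 108] -/
theorem hitPoint_cylPoint {ε : ℝ} (hε : 0 ≤ ε) {u ν : V} (hν : ‖ν‖ = 1) (huν : 0 < ⟪u, ν⟫_ℝ) (τ : ℝ) :
    hitPoint ε (ε • ν + τ • u, -u) = ε • ν := by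
  have hu : u ≠ 0 := fun h => by simp [h] at huν
  simp only [hitPoint]
  rw [pairHitTime_cylPoint hε hν huν.le hu τ, smul_neg, add_neg_cancel_right]

/-- **Points of the open cylinder are billiard-good**: `(ε ν + τ u, -u)` with `ν` unit, `⟪u, ν⟫ > 0`, `τ > 0`,
`ε > 0` is strictly outside the ball, approaching, with positive discriminant. [folklore] -/
theorem cylPoint_mem_billiardGood {ε : ℝ} (hε : 0 < ε) {u ν : V} (hν : ‖ν‖ = 1) (huν : 0 < ⟪u, ν⟫_ℝ) {τ : ℝ}
    (hτ : 0 < τ) : (ε • ν + τ • u, -u) ∈ (billiardGood ε : Set (V × V)) := by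
  have hu : u ≠ 0 := fun h => by simp [h] at huν
  have hu2 : 0 < ‖u‖ ^ 2 := pow_pos (norm_pos_iff.2 hu) 2
  refine ⟨?_, ?_, ?_⟩
  · have h : ε ^ 2 < ‖ε • ν + τ • u‖ ^ 2 := by
      rw [norm_cylPoint_sq ε u hν τ]
      nlinarith [mul_pos (mul_pos hε hτ) huν, mul_pos (pow_pos hτ 2) hu2]
    exact lt_of_pow_lt_pow_left₀ 2 (norm_nonneg _) h
  · show ⟪ε • ν + τ • u, -u⟫_ℝ < 0
    rw [inner_cylPoint_neg ε u ν τ]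
    nlinarith [mul_pos hε huν, mul_pos hτ hu2]
  · show 0 < pairDisc ε (ε • ν + τ • u) (-u)
    rw [pairDisc_cylPoint ε u hν τ]
    exact pow_pos (mul_pos hε huν) 2

/-! ## §2. The collision cylinder of length `Δ` -/

/-- The direction–time parameters of flight time at most `Δ`: `{y | 0 < ⟪u, y⟫, ‖y‖ ≤ Δ}` (direction `y/‖y‖`, time
`‖y‖`, as in `collisionCylMap`). [folklore] -/
def collisionCylDomUpTo (u : V) (Δ : ℝ) : Set V := collisionCylDom u ∩ {y | ‖y‖ ≤ Δ}

/-- Membership in the truncated parameter domain. [folklore] -/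
theorem mem_collisionCylDomUpTo {u y : V} {Δ : ℝ} : y ∈ collisionCylDomUpTo u Δ ↔ 0 < ⟪u, y⟫_ℝ ∧ ‖y‖ ≤ Δ := Iff.rfl

/-- The truncated parameter domain lies in the outgoing half-space. [folklore] -/
theorem collisionCylDomUpTo_subset (u : V) (Δ : ℝ) : collisionCylDomUpTo u Δ ⊆ collisionCylDom u := inter_subset_left

/-- `τ ν` (unit `ν`, `τ > 0`) is a truncated parameter iff `⟪u, ν⟫ > 0` and `τ ≤ Δ`. [folklore] -/
theorem smul_mem_collisionCylDomUpTo_iff {u ν : V} (hν : ‖ν‖ = 1) {τ Δ : ℝ} (hτ : 0 < τ) :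
    τ • ν ∈ collisionCylDomUpTo u Δ ↔ ν ∈ collisionCylDom u ∧ τ ≤ Δ := by
  rw [mem_collisionCylDomUpTo, mem_collisionCylDom, inner_smul_right, norm_smul, hν, mul_one, Real.norm_of_nonneg hτ.le]
  exact ⟨fun h => ⟨pos_of_mul_pos_right h.1 hτ.le, h.2⟩, fun h => ⟨mul_pos hτ h.1, h.2⟩⟩

/-- **The collision cylinder of length `Δ`** swept by the sphere of radius `ε` moving with relative velocity `-u` during a
time `Δ`: `{ε ν + τ u | ⟪u, ν⟫ > 0, 0 < τ ≤ Δ}` (CIP 1994 §2.3, App. 4.A). [cite: CIP1994, App. 4.A p. 108] -/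
def collisionCylRegionUpTo (ε : ℝ) (u : V) (Δ : ℝ) : Set V := collisionCylMap ε u '' collisionCylDomUpTo u Δ

/-- The cylinder of length `Δ` is part of the full cylinder. [folklore] -/
theorem collisionCylRegionUpTo_subset (ε : ℝ) (u : V) (Δ : ℝ) :
    collisionCylRegionUpTo ε u Δ ⊆ collisionCylRegion ε u := image_mono (collisionCylDomUpTo_subset u Δ)

/-- The cylinders of length `Δ` increase with `Δ`. [folklore] -/
theorem collisionCylRegionUpTo_mono (ε : ℝ) (u : V) {Δ Δ' : ℝ} (h : Δ ≤ Δ') :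
    collisionCylRegionUpTo ε u Δ ⊆ collisionCylRegionUpTo ε u Δ' :=
  image_mono fun _ hy => ⟨hy.1, hy.2.trans h⟩

/-- **The cylinder of length `Δ` in billiard currency**: `q` lies in it iff the relative datum `(q, -u)` is billiard-good
(strictly outside, approaching, non-grazing) with first hitting time `≤ Δ` — i.e. iff a partner at relative position `q`
moving with relative velocity `-u` collides non-grazingly within time `Δ` (`ε > 0`). [cite: CIP1994, §2.3] -/
theorem mem_collisionCylRegionUpTo_iff {ε : ℝ} (hε : 0 < ε) (u : V) {Δ : ℝ} {q : V} :
    q ∈ collisionCylRegionUpTo ε u Δ ↔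
      (q, -u) ∈ (billiardGood ε : Set (V × V)) ∧ pairHitTime ε q (-u) ≤ Δ := by
  constructor
  · rintro ⟨y, hy, rfl⟩
    have hy0 : y ≠ 0 := ne_zero_of_mem_collisionCylDom hy.1
    have hn : 0 < ‖y‖ := norm_pos_iff.2 hy0
    set ν : V := ‖y‖⁻¹ • y with hνdef
    have hν : ‖ν‖ = 1 := by rw [hνdef, norm_smul, norm_inv, norm_norm, inv_mul_cancel₀ hn.ne']
    have hye : y = ‖y‖ • ν := by rw [hνdef, smul_smul, mul_inv_cancel₀ hn.ne', one_smul]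
    have huν : 0 < ⟪u, ν⟫_ℝ := by
      rw [hνdef, inner_smul_right]; exact mul_pos (inv_pos.2 hn) hy.1
    have hu : u ≠ 0 := fun h => by simp [h] at huν
    rw [hye, collisionCylMap_smul_unit ε u hν hn]
    exact ⟨cylPoint_mem_billiardGood hε hν huν hn, by rw [pairHitTime_cylPoint hε.le hν huν.le hu]; exact hy.2⟩
  · rintro ⟨hgood, hΔ⟩
    have hhits : PairHits ε q (-u) := PairHits.of_mem_billiardGood hgood
    have hτ : 0 < pairHitTime ε q (-u) := pairHitTime_pos hε.le hgood.1 hhits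
    have hnε : ‖hitPoint ε (q, -u)‖ = ε := norm_hitPoint hε.le hgood
    have hneg : ⟪hitPoint ε (q, -u), -u⟫_ℝ < 0 := inner_hitPoint_neg hgood
    have hnu : 0 < ⟪u, hitPoint ε (q, -u)⟫_ℝ := by
      rw [inner_neg_right] at hneg
      rw [real_inner_comm (hitPoint ε (q, -u)) u]
      linarith
    have hν : ‖ε⁻¹ • hitPoint ε (q, -u)‖ = 1 := by
      rw [norm_smul, norm_inv, Real.norm_of_nonneg hε.le, hnε, inv_mul_cancel₀ hε.ne']
    refine ⟨pairHitTime ε q (-u) • (ε⁻¹ • hitPoint ε (q, -u)), ⟨?_, ?_⟩, ?_⟩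
    · show 0 < ⟪u, pairHitTime ε q (-u) • (ε⁻¹ • hitPoint ε (q, -u))⟫_ℝ
      rw [inner_smul_right, inner_smul_right]
      exact mul_pos hτ (mul_pos (inv_pos.2 hε) hnu)
    · show ‖pairHitTime ε q (-u) • (ε⁻¹ • hitPoint ε (q, -u))‖ ≤ Δ
      rw [norm_smul, hν, mul_one, Real.norm_of_nonneg hτ.le]
      exact hΔ
    · rw [collisionCylMap_smul_unit ε u hν hτ, smul_smul, mul_inv_cancel₀ hε.ne', one_smul]
      simp only [hitPoint, smul_neg]
      abel

/-- On the cylinder of length `Δ` the hitting time is positive and at most `Δ`. [folklore] -/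
theorem pairHitTime_mem_Ioc_of_mem_collisionCylRegionUpTo {ε : ℝ} (hε : 0 < ε) {u : V} {Δ : ℝ} {q : V}
    (hq : q ∈ collisionCylRegionUpTo ε u Δ) : pairHitTime ε q (-u) ∈ Ioc 0 Δ := by
  obtain ⟨hgood, hΔ⟩ := (mem_collisionCylRegionUpTo_iff hε u).1 hq
  exact ⟨pairHitTime_pos hε.le hgood.1 (PairHits.of_mem_billiardGood hgood), hΔ⟩

/-- The hit point is a continuous function of the relative position (explicit root formula). [folklore] -/
theorem continuous_hitPoint_left (ε : ℝ) (w : V) : Continuous fun q : V => hitPoint ε (q, w) := by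
  have h1 : Continuous fun q : V => pairHitTime ε q w := by
    unfold pairHitTime pairDisc
    fun_prop
  show Continuous fun q : V => q + pairHitTime ε q w • w
  exact continuous_id.add (h1.smul continuous_const)

section Measure

variable [FiniteDimensional ℝ V] [MeasurableSpace V] [BorelSpace V] (μ : Measure V) [μ.IsAddHaarMeasure]

omit [FiniteDimensional ℝ V] in
/-- The truncated parameter domain is measurable. [folklore] -/
theorem measurableSet_collisionCylDomUpTo (u : V) (Δ : ℝ) : MeasurableSet (collisionCylDomUpTo u Δ) := by
  unfold collisionCylDomUpTo
  exact (measurableSet_collisionCylDom u).inter (isClosed_le continuous_norm continuous_const).measurableSet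

/-! ## §3. The cylinder formula for the cylinder of length `Δ` -/

/-- **Change of variables in the bulk parameters, length `Δ`**: for `g ≥ 0`,
`∫⁻_{cyl_Δ} g dμ = ∫⁻_{collisionCylDomUpTo u Δ} (ε/‖y‖)^{n-1} (⟪u,y⟫/‖y‖) g(collisionCylMap ε u y) dμ(y)`
(`lintegral_image_eq_lintegral_abs_det_fderiv_mul`, `det_collisionCylDeriv`, `injOn_collisionCylMap`). [folklore] -/
theorem lintegral_collisionCylRegionUpTo_eq [Nontrivial V] {ε : ℝ} (hε : 0 < ε) (u : V) (Δ : ℝ) (g : V → ℝ≥0∞) :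
    ∫⁻ r in collisionCylRegionUpTo ε u Δ, g r ∂μ =
      ∫⁻ y in collisionCylDomUpTo u Δ,
        ENNReal.ofReal ((ε / ‖y‖) ^ (finrank ℝ V - 1) * (⟪u, y⟫_ℝ / ‖y‖)) * g (collisionCylMap ε u y) ∂μ := by
  rw [collisionCylRegionUpTo, lintegral_image_eq_lintegral_abs_det_fderiv_mul μ (measurableSet_collisionCylDomUpTo u Δ)
    (fun y hy => (hasFDerivAt_collisionCylMap ε u (ne_zero_of_mem_collisionCylDom hy.1)).hasFDerivWithinAt)
    ((injOn_collisionCylMap hε u).mono (collisionCylDomUpTo_subset u Δ)) g]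
  refine setLIntegral_congr_fun (measurableSet_collisionCylDomUpTo u Δ) fun y hy => ?_
  have hy0 := ne_zero_of_mem_collisionCylDom hy.1
  rw [det_collisionCylDeriv hε.ne' u hy0, abs_of_nonneg]
  exact mul_nonneg (pow_nonneg (div_nonneg hε.le (norm_nonneg _)) _) (div_nonneg (le_of_lt hy.1) (norm_nonneg _))

/-- **The collision cylinder formula, length `Δ`** (CIP 1994 App. 4.A: `dx = ε^{d-1} |v · n| dσ(n) dτ`, flight time
restricted to `0 < τ ≤ Δ`): for measurable `g ≥ 0`,
`∫⁻_{cyl_Δ} g dμ = ∫⁻ ν ∂μ.toSphere, ∫⁻ τ in Ioc 0 Δ, 1_{0 < ⟪u,ν⟫} ε^{n-1} ⟪u, ν⟫ g(ε ν + τ u) dτ`.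
[cite: CIP1994, App. 4.A p. 108] -/
theorem lintegral_collisionCylinderUpTo [Nontrivial V] {ε : ℝ} (hε : 0 < ε) (u : V) (Δ : ℝ) (g : V → ℝ≥0∞)
    (hg : Measurable g) :
    ∫⁻ r in collisionCylRegionUpTo ε u Δ, g r ∂μ =
      ∫⁻ ν : sphere (0 : V) 1, ∫⁻ τ in Ioc (0 : ℝ) Δ,
        (collisionCylDom u).indicator (fun _ => (1 : ℝ≥0∞)) (ν : V) *
          (ENNReal.ofReal (ε ^ (finrank ℝ V - 1) * ⟪u, (ν : V)⟫_ℝ) * g (ε • (ν : V) + τ • u)) ∂volume ∂μ.toSphere := by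
  classical
  set F : V → ℝ≥0∞ := fun y =>
    ENNReal.ofReal ((ε / ‖y‖) ^ (finrank ℝ V - 1) * (⟪u, y⟫_ℝ / ‖y‖)) * g (collisionCylMap ε u y) with hF
  have hFm : Measurable F := by
    have h1 : Measurable fun y : V => (ε / ‖y‖) ^ (finrank ℝ V - 1) * (⟪u, y⟫_ℝ / ‖y‖) := by fun_prop
    have h2 : Measurable (collisionCylMap ε u) := by unfold collisionCylMap; fun_prop
    exact h1.ennreal_ofReal.mul (hg.comp h2)
  rw [lintegral_collisionCylRegionUpTo_eq μ hε u Δ g, ← lintegral_indicator (measurableSet_collisionCylDomUpTo u Δ),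
    lintegral_polar μ _ (hFm.indicator (measurableSet_collisionCylDomUpTo u Δ))]
  refine lintegral_congr fun ν => ?_
  have hν : ‖(ν : V)‖ = 1 := by simp
  -- write the right-hand side as an integral over `Ioi 0` of an `Iic Δ`-indicator
  have hsplit : ∫⁻ τ in Ioc (0 : ℝ) Δ,
      (collisionCylDom u).indicator (fun _ => (1 : ℝ≥0∞)) (ν : V) *
        (ENNReal.ofReal (ε ^ (finrank ℝ V - 1) * ⟪u, (ν : V)⟫_ℝ) * g (ε • (ν : V) + τ • u)) ∂volume =
      ∫⁻ τ in Ioi (0 : ℝ), (Iic Δ).indicator (fun τ => (collisionCylDom u).indicator (fun _ => (1 : ℝ≥0∞)) (ν : V) *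
        (ENNReal.ofReal (ε ^ (finrank ℝ V - 1) * ⟪u, (ν : V)⟫_ℝ) * g (ε • (ν : V) + τ • u))) τ ∂volume := by
    rw [lintegral_indicator measurableSet_Iic, Measure.restrict_restrict measurableSet_Iic,
      Set.inter_comm (Iic Δ) (Ioi 0), Ioi_inter_Iic]
  rw [hsplit]
  refine setLIntegral_congr_fun measurableSet_Ioi fun τ hτ => ?_
  have hτ0 : 0 < τ := hτ
  by_cases hmem : (ν : V) ∈ collisionCylDom u
  · by_cases hτΔ : τ ≤ Δ
    · rw [indicator_of_mem ((smul_mem_collisionCylDomUpTo_iff hν hτ0).2 ⟨hmem, hτΔ⟩),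
        indicator_of_mem (show τ ∈ Iic Δ from hτΔ), indicator_of_mem hmem, one_mul, hF]
      simp only
      rw [collisionCylMap_smul_unit ε u hν hτ0, norm_smul, hν, mul_one, Real.norm_of_nonneg hτ0.le, inner_smul_right,
        ← mul_assoc, ← ENNReal.ofReal_mul (pow_nonneg hτ0.le _)]
      congr 2
      have hn : 1 ≤ finrank ℝ V := Module.finrank_pos
      obtain ⟨m, hm⟩ : ∃ m, finrank ℝ V = m + 1 := ⟨finrank ℝ V - 1, by omega⟩
      rw [hm, Nat.add_sub_cancel, div_pow]
      field_simp
    · rw [indicator_of_notMem (fun h => hτΔ ((smul_mem_collisionCylDomUpTo_iff hν hτ0).1 h).2),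
        indicator_of_notMem (show τ ∉ Iic Δ from hτΔ), mul_zero]
  · rw [indicator_of_notMem (fun h => hmem ((smul_mem_collisionCylDomUpTo_iff hν hτ0).1 h).1), mul_zero]
    by_cases hτΔ : τ ≤ Δ
    · rw [indicator_of_mem (show τ ∈ Iic Δ from hτΔ), indicator_of_notMem hmem, zero_mul]
    · rw [indicator_of_notMem (show τ ∉ Iic Δ from hτΔ)]

/-- **The marked cylinder identity** (CIP 1994 §2.3 / App. 4.A: the contacts produced during a time `Δ` by partners of
relative velocity `-u` are distributed on the hemisphere `⟪u, ν⟫ > 0` with density `Δ ε^{d-1} ⟪u, ν⟫ dσ(ν)`): if a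
measurable `g ≥ 0` depends on the point `ε ν + τ u` of the cylinder of length `Δ` only through the impact direction `ν`,
`g(ε ν + τ u) = H ν`, then `∫⁻_{cyl_Δ} g dμ = Δ · ∫⁻ ν, ε^{n-1} (⟪u, ν⟫)₊ H(ν) ∂μ.toSphere`.
[cite: CIP1994, App. 4.A p. 108] -/
theorem lintegral_collisionCylinderUpTo_of_mark [Nontrivial V] {ε : ℝ} (hε : 0 < ε) (u : V) (Δ : ℝ)
    (g : V → ℝ≥0∞) (hg : Measurable g) (H : V → ℝ≥0∞)
    (hH : ∀ ν : V, ‖ν‖ = 1 → 0 < ⟪u, ν⟫_ℝ → ∀ τ : ℝ, 0 < τ → τ ≤ Δ → g (ε • ν + τ • u) = H ν) :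
    ∫⁻ r in collisionCylRegionUpTo ε u Δ, g r ∂μ =
      ENNReal.ofReal Δ *
        ∫⁻ ν : sphere (0 : V) 1, ENNReal.ofReal (ε ^ (finrank ℝ V - 1) * max ⟪u, (ν : V)⟫_ℝ 0) * H ν ∂μ.toSphere := by
  rw [lintegral_collisionCylinderUpTo μ hε u Δ g hg, ← lintegral_const_mul' _ _ ENNReal.ofReal_ne_top]
  refine lintegral_congr fun ν => ?_
  have hν : ‖(ν : V)‖ = 1 := by simp
  by_cases hmem : (ν : V) ∈ collisionCylDom u
  · have hpos : 0 < ⟪u, (ν : V)⟫_ℝ := hmem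
    have key : ∀ τ ∈ Ioc (0 : ℝ) Δ,
        (collisionCylDom u).indicator (fun _ => (1 : ℝ≥0∞)) (ν : V) *
            (ENNReal.ofReal (ε ^ (finrank ℝ V - 1) * ⟪u, (ν : V)⟫_ℝ) * g (ε • (ν : V) + τ • u)) =
          ENNReal.ofReal (ε ^ (finrank ℝ V - 1) * max ⟪u, (ν : V)⟫_ℝ 0) * H ν := by
      intro τ hτ
      rw [indicator_of_mem hmem, one_mul, hH ν hν hpos τ hτ.1 hτ.2, max_eq_left hpos.le]
    rw [setLIntegral_congr_fun measurableSet_Ioc key, setLIntegral_const, Real.volume_Ioc, sub_zero]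
    ring
  · have hle : ⟪u, (ν : V)⟫_ℝ ≤ 0 := not_lt.1 hmem
    have key : ∀ τ ∈ Ioc (0 : ℝ) Δ,
        (collisionCylDom u).indicator (fun _ => (1 : ℝ≥0∞)) (ν : V) *
            (ENNReal.ofReal (ε ^ (finrank ℝ V - 1) * ⟪u, (ν : V)⟫_ℝ) * g (ε • (ν : V) + τ • u)) = 0 := by
      intro τ _
      rw [indicator_of_notMem hmem, zero_mul]
    rw [setLIntegral_congr_fun measurableSet_Ioc key, lintegral_zero, max_eq_right hle, mul_zero, ENNReal.ofReal_zero,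
      zero_mul, mul_zero]

/-- **The marked cylinder identity for the impact direction read at the contact**: with the mark
`ε⁻¹ · hitPoint ε (q, -u)` (the unit separation vector at the first contact of the relative free motion),
`∫⁻_{cyl_Δ} Ψ(ε⁻¹ hitPoint) dμ(q) = Δ · ∫⁻ ν, ε^{n-1} (⟪u, ν⟫)₊ Ψ(ν) ∂μ.toSphere` for every measurable `Ψ ≥ 0`.
[cite: CIP1994, App. 4.A p. 108] -/
theorem lintegral_collisionCylinderUpTo_hitPoint [Nontrivial V] {ε : ℝ} (hε : 0 < ε) (u : V) (Δ : ℝ)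
    (Ψ : V → ℝ≥0∞) (hΨ : Measurable Ψ) :
    ∫⁻ q in collisionCylRegionUpTo ε u Δ, Ψ (ε⁻¹ • hitPoint ε (q, -u)) ∂μ =
      ENNReal.ofReal Δ *
        ∫⁻ ν : sphere (0 : V) 1, ENNReal.ofReal (ε ^ (finrank ℝ V - 1) * max ⟪u, (ν : V)⟫_ℝ 0) * Ψ ν ∂μ.toSphere :=
  lintegral_collisionCylinderUpTo_of_mark μ hε u Δ _
    (hΨ.comp ((continuous_hitPoint_left ε (-u)).const_smul ε⁻¹).measurable) Ψ
    (fun ν hν huν τ _ _ => by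
      show Ψ (ε⁻¹ • hitPoint ε (ε • ν + τ • u, -u)) = Ψ ν
      rw [hitPoint_cylPoint hε.le hν huν τ, smul_smul, inv_mul_cancel₀ hε.ne', one_smul])

/-- **The volume of the cylinder of length `Δ`**: `μ(cyl_Δ) = Δ · ∫ ε^{n-1} (⟪u, ν⟫)₊ dσ(ν)`
(`= Δ ε^{n-1} |B^{n-1}| ‖u‖`, the classical `π ε² |u| Δ` in dimension three). [cite: CIP1994, §2.3] -/
theorem measure_collisionCylRegionUpTo [Nontrivial V] {ε : ℝ} (hε : 0 < ε) (u : V) (Δ : ℝ) :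
    μ (collisionCylRegionUpTo ε u Δ) =
      ENNReal.ofReal Δ * ∫⁻ ν : sphere (0 : V) 1, ENNReal.ofReal (ε ^ (finrank ℝ V - 1) * max ⟪u, (ν : V)⟫_ℝ 0) ∂μ.toSphere := by
  have h := lintegral_collisionCylinderUpTo_of_mark μ hε u Δ (fun _ => 1) measurable_const (fun _ => 1)
    (fun _ _ _ _ _ _ => rfl)
  simp only [mul_one, setLIntegral_const, one_mul] at h
  simpa using h

/-- The cylinder of length `Δ` has finite measure. [folklore] -/
theorem measure_collisionCylRegionUpTo_lt_top [Nontrivial V] {ε : ℝ} (hε : 0 < ε) (u : V) (Δ : ℝ) :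
    μ (collisionCylRegionUpTo ε u Δ) < ∞ := by
  rw [measure_collisionCylRegionUpTo μ hε u Δ]
  refine ENNReal.mul_lt_top ENNReal.ofReal_lt_top ?_
  have hfin : IsFiniteMeasure μ.toSphere := by infer_instance
  refine lt_of_le_of_lt (lintegral_mono (g := fun _ => ENNReal.ofReal (ε ^ (finrank ℝ V - 1) * ‖u‖)) fun ν => ?_) ?_
  · refine ENNReal.ofReal_le_ofReal (mul_le_mul_of_nonneg_left ?_ (pow_nonneg hε.le _))
    refine max_le ?_ (norm_nonneg _)
    calc ⟪u, (ν : V)⟫_ℝ ≤ ‖u‖ * ‖(ν : V)‖ := real_inner_le_norm _ _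
      _ = ‖u‖ := by simp
  · rw [lintegral_const]
    exact ENNReal.mul_lt_top ENNReal.ofReal_lt_top (measure_lt_top _ _)

/-! ## §4. The push-forward form and the Bochner (real-valued) form -/

omit [μ.IsAddHaarMeasure] in
/-- The cylinder of length `Δ` is measurable (image of a measurable set under an injective differentiable map,
`MeasureTheory.measurable_image_of_fderivWithin`). [folklore] -/
theorem measurableSet_collisionCylRegionUpTo {ε : ℝ} (hε : 0 < ε) (u : V) (Δ : ℝ) :
    MeasurableSet (collisionCylRegionUpTo ε u Δ) :=
  measurable_image_of_fderivWithin (measurableSet_collisionCylDomUpTo u Δ)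
    (fun _ hy => (hasFDerivAt_collisionCylMap ε u (ne_zero_of_mem_collisionCylDom hy.1)).hasFDerivWithinAt)
    ((injOn_collisionCylMap hε u).mono (collisionCylDomUpTo_subset u Δ))

/-- **The law of the impact direction on the cylinder of length `Δ`**: the push-forward of `μ` restricted to the
cylinder under the mark `q ↦ ε⁻¹ hitPoint ε (q, -u)` is `Δ` times the flux measure `ε^{n-1} (⟪u, ν⟫)₊ dσ(ν)` of the
unit sphere (viewed in `V`). [cite: CIP1994, App. 4.A p. 108] -/
theorem map_hitDir_restrict_collisionCylRegionUpTo [Nontrivial V] {ε : ℝ} (hε : 0 < ε) (u : V) (Δ : ℝ) :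
    (μ.restrict (collisionCylRegionUpTo ε u Δ)).map (fun q => ε⁻¹ • hitPoint ε (q, -u)) =
      ENNReal.ofReal Δ •
        (μ.toSphere.withDensity fun ν => ENNReal.ofReal (ε ^ (finrank ℝ V - 1) * max ⟪u, (ν : V)⟫_ℝ 0)).map
          ((↑) : sphere (0 : V) 1 → V) := by
  classical
  have hmark : Measurable fun q : V => ε⁻¹ • hitPoint ε (q, -u) :=
    ((continuous_hitPoint_left ε (-u)).const_smul ε⁻¹).measurable
  have hD : Measurable fun ν : sphere (0 : V) 1 => ENNReal.ofReal (ε ^ (finrank ℝ V - 1) * max ⟪u, (ν : V)⟫_ℝ 0) := by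
    fun_prop
  ext s hs
  rw [Measure.map_apply hmark hs, Measure.smul_apply, Measure.map_apply measurable_subtype_coe hs,
    withDensity_apply _ (measurable_subtype_coe hs), smul_eq_mul, ← lintegral_indicator (measurable_subtype_coe hs),
    ← lintegral_indicator_one (hmark hs)]
  have h1 : ∫⁻ q in collisionCylRegionUpTo ε u Δ, ((fun q : V => ε⁻¹ • hitPoint ε (q, -u)) ⁻¹' s).indicator 1 q ∂μ =
      ∫⁻ q in collisionCylRegionUpTo ε u Δ, s.indicator (fun _ => (1 : ℝ≥0∞)) (ε⁻¹ • hitPoint ε (q, -u)) ∂μ := by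
    refine lintegral_congr fun q => ?_
    by_cases hq : ε⁻¹ • hitPoint ε (q, -u) ∈ s
    · rw [indicator_of_mem hq, indicator_of_mem (show q ∈ (fun q : V => ε⁻¹ • hitPoint ε (q, -u)) ⁻¹' s from hq),
        Pi.one_apply]
    · rw [indicator_of_notMem hq, indicator_of_notMem (show q ∉ (fun q : V => ε⁻¹ • hitPoint ε (q, -u)) ⁻¹' s from hq)]
  rw [h1, lintegral_collisionCylinderUpTo_hitPoint μ hε u Δ _ (measurable_const.indicator hs)]
  congr 1
  refine lintegral_congr fun ν => ?_
  by_cases hν : (ν : V) ∈ s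
  · rw [indicator_of_mem hν, indicator_of_mem (show ν ∈ ((↑) : sphere (0 : V) 1 → V) ⁻¹' s from hν), mul_one]
  · rw [indicator_of_notMem hν, indicator_of_notMem (show ν ∉ ((↑) : sphere (0 : V) 1 → V) ⁻¹' s from hν), mul_zero]

/-- **The marked cylinder identity, Bochner form**: for a real measurable test `Ψ` of the impact direction,
`∫_{cyl_Δ} Ψ(ε⁻¹ hitPoint ε (q, -u)) dμ(q) = Δ · ∫ ε^{n-1} (⟪u, ν⟫)₊ Ψ(ν) ∂μ.toSphere` (no integrability hypothesis:
both sides are finite-measure integrals of the same function, by `map_hitDir_restrict_collisionCylRegionUpTo`).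
[cite: CIP1994, App. 4.A p. 108] -/
theorem integral_collisionCylinderUpTo_hitPoint [Nontrivial V] {ε : ℝ} (hε : 0 < ε) (u : V) {Δ : ℝ} (hΔ : 0 ≤ Δ)
    (Ψ : V → ℝ) (hΨ : Measurable Ψ) :
    ∫ q in collisionCylRegionUpTo ε u Δ, Ψ (ε⁻¹ • hitPoint ε (q, -u)) ∂μ =
      Δ * ∫ ν : sphere (0 : V) 1, (ε ^ (finrank ℝ V - 1) * max ⟪u, (ν : V)⟫_ℝ 0) * Ψ ν ∂μ.toSphere := by
  have hmark : Measurable fun q : V => ε⁻¹ • hitPoint ε (q, -u) :=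
    ((continuous_hitPoint_left ε (-u)).const_smul ε⁻¹).measurable
  have hD : Measurable fun ν : sphere (0 : V) 1 => ENNReal.ofReal (ε ^ (finrank ℝ V - 1) * max ⟪u, (ν : V)⟫_ℝ 0) := by
    fun_prop
  calc ∫ q in collisionCylRegionUpTo ε u Δ, Ψ (ε⁻¹ • hitPoint ε (q, -u)) ∂μ
      = ∫ x, Ψ x ∂((μ.restrict (collisionCylRegionUpTo ε u Δ)).map (fun q => ε⁻¹ • hitPoint ε (q, -u))) :=
        (integral_map hmark.aemeasurable hΨ.aestronglyMeasurable).symm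
    _ = ∫ x, Ψ x ∂(ENNReal.ofReal Δ •
          (μ.toSphere.withDensity fun ν => ENNReal.ofReal (ε ^ (finrank ℝ V - 1) * max ⟪u, (ν : V)⟫_ℝ 0)).map
            ((↑) : sphere (0 : V) 1 → V)) := by
        rw [map_hitDir_restrict_collisionCylRegionUpTo μ hε u Δ]
    _ = Δ * ∫ ν : sphere (0 : V) 1, Ψ ν
          ∂(μ.toSphere.withDensity fun ν => ENNReal.ofReal (ε ^ (finrank ℝ V - 1) * max ⟪u, (ν : V)⟫_ℝ 0)) := by
        rw [integral_smul_measure, integral_map measurable_subtype_coe.aemeasurable hΨ.aestronglyMeasurable,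
          ENNReal.toReal_ofReal hΔ, smul_eq_mul]
    _ = Δ * ∫ ν : sphere (0 : V) 1, (ε ^ (finrank ℝ V - 1) * max ⟪u, (ν : V)⟫_ℝ 0) * Ψ ν ∂μ.toSphere := by
        rw [integral_withDensity_eq_integral_toReal_smul hD (Eventually.of_forall fun _ => ENNReal.ofReal_lt_top)]
        congr 1
        refine integral_congr_ae (Eventually.of_forall fun ν => ?_)
        simp only [smul_eq_mul]
        rw [ENNReal.toReal_ofReal (mul_nonneg (pow_nonneg hε.le _) (le_max_right _ _))]

/-! ## §5. In the currency of the kinetic-theory files: `hardSphereKernel` and `sphereMeasure` -/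

open Literature.MathematicalPhysics.KineticTheory (hardSphereKernel sphereMeasure)

omit μ

/-- **The marked cylinder identity with Boltzmann's hard-sphere kernel**: for a tagged particle of velocity `v` and a
partner of velocity `w` (relative velocity of the tagged particle `v - w`), the relative positions
`q = x_tagged - x_partner` from which the pair collides non-grazingly within time `Δ` form the cylinder
`collisionCylRegionUpTo ε (w - v) Δ`, the unit separation vector at contact is `ω = ε⁻¹ hitPoint ε (q, v - w)`, and for
every measurable `Ψ ≥ 0`,
`∫⁻_{cyl_Δ} Ψ(ω(q)) dq = Δ ε^{d-1} ∫⁻ Ψ(ω) ((w - v) · ω)₊ d sphereMeasure(ω)`,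
`((w - v) · ω)₊ = hardSphereKernel (w, v) ω` — the flux factor of the Boltzmann collision operator, positive exactly on the
pre-collisional hemisphere (CIP 1994 §2.3, (3.1.4); App. 4.A p. 108). [cite: CIP1994, App. 4.A p. 108] -/
theorem lintegral_collisionCylinderUpTo_hardSphereKernel [Nontrivial V] (v w : V) {ε : ℝ} (hε : 0 < ε) (Δ : ℝ)
    (Ψ : V → ℝ≥0∞) (hΨ : Measurable Ψ) :
    ∫⁻ q in collisionCylRegionUpTo ε (w - v) Δ, Ψ (ε⁻¹ • hitPoint ε (q, v - w)) =
      ENNReal.ofReal (Δ * ε ^ (finrank ℝ V - 1)) *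
        ∫⁻ ω : sphere (0 : V) 1, Ψ ω * ENNReal.ofReal (hardSphereKernel (w, v) ω) ∂sphereMeasure := by
  have h := lintegral_collisionCylinderUpTo_hitPoint (volume : Measure V) hε (w - v) Δ Ψ hΨ
  rw [neg_sub] at h
  rw [h, ENNReal.ofReal_mul' (pow_nonneg hε.le _), mul_assoc]
  congr 1
  rw [show (sphereMeasure : Measure (sphere (0 : V) 1)) = (volume : Measure V).toSphere from rfl,
    ← lintegral_const_mul' _ _ ENNReal.ofReal_ne_top]
  refine lintegral_congr fun ω => ?_
  rw [ENNReal.ofReal_mul (pow_nonneg hε.le _)]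
  simp only [hardSphereKernel]
  ring

/-- **The marked cylinder identity with Boltzmann's hard-sphere kernel, Bochner form**: for a real measurable test `Ψ`
of the impact direction, `∫_{cyl_Δ} Ψ(ε⁻¹ hitPoint ε (q, v - w)) dq = Δ ε^{d-1} ∫ Ψ(ω) hardSphereKernel (w, v) ω d sphereMeasure(ω)`
— for `d = 3` and `Ψ = Ξ(·, v, w)` the right-hand side is `Δ ε²` times the flux-weighted sphere average
`∫ Ξ(ω, v, w) hardSphereKernel (w, v) ω ∂sphereMeasure` of the hydrodynamic-limit statements. [cite: CIP1994, App. 4.A p. 108] -/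
theorem integral_collisionCylinderUpTo_hardSphereKernel [Nontrivial V] (v w : V) {ε : ℝ} (hε : 0 < ε) {Δ : ℝ}
    (hΔ : 0 ≤ Δ) (Ψ : V → ℝ) (hΨ : Measurable Ψ) :
    ∫ q in collisionCylRegionUpTo ε (w - v) Δ, Ψ (ε⁻¹ • hitPoint ε (q, v - w)) =
      Δ * ε ^ (finrank ℝ V - 1) * ∫ ω : sphere (0 : V) 1, Ψ ω * hardSphereKernel (w, v) ω ∂sphereMeasure := by
  have h := integral_collisionCylinderUpTo_hitPoint (volume : Measure V) hε (w - v) hΔ Ψ hΨ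
  rw [neg_sub] at h
  rw [h, mul_assoc]
  congr 1
  rw [show (sphereMeasure : Measure (sphere (0 : V) 1)) = (volume : Measure V).toSphere from rfl, ← integral_const_mul]
  refine integral_congr_ae (Eventually.of_forall fun ω => ?_)
  simp only [hardSphereKernel]
  ring
end Measure

end Kinetic

end

end Literature.Analysis.FluidPDE
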